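import Literature.AlgebraicTopology.SingularHomology.SubsetCochains
import Literature.AlgebraicTopology.SingularHomology.CohomologyHomotopyInvariance
import Literature.AlgebraicTopology.SingularHomology.CohomologyOfPoint
import HarnessLib

/-!
# The cohomology of a contractible open subset computed in `C(X)` vanishes in positive degrees

H. Miller, *Lectures on Algebraic Topology* (2020), §34 (p. 112 of the held copy, Lemma 34.5 and
the discussion before Def. 34.4): Čech cohomology `Ȟ^p(K) = lim_→ H^p(U)` may be computed along
any cofinal family of neighbourhoods, and for neighbourhoods `V` with the homotopy type of a point
`H^p(V) = 0` for `p > 0`; proof of Thm. 37.1 step (1) ("`Ȟ^*(K) → H^*(K)` … is of course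
isomorphic to `H^*(*)`"). A. Hatcher, *Algebraic Topology* (2002), §3.1 p. 201 (homotopy
invariance of cohomology) and p. 199 (`Hⁿ(pt) = 0` for `n > 0`).

The tree computes the cohomology of an open `W ⊆ X` *inside `C(X)`*:
`H^p_X(W; N) = H^p(Hom_R(C_X(W), N))` (`subsetCochains`, `SubsetCochains.lean`), while homotopy
invariance and the cohomology of a point are proved for the function cochain complex
`singularCochainComplex R M Y` of a *space* `Y` (`CohomologyHomotopyInvariance.lean`,
`CohomologyOfPoint.lean`). This file supplies the comparison for coefficients `N = ULift R`:

* `subsetCochains.isoSingularCochainComplex` — the isomorphism of cochain complexes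
  `Hom_R(C_X(W), ULift R) ≅ C^•(↥W; R)`, composed of the duals of `C(↥W) ≅ C_X(W)`
  (`subspaceIso`) and of the comparison with Mathlib's chains (`csingularChainComplex.compIso`),
  and of `singularCochainComplex.cochainIso`;
* `subsetCochains.homologyIsoSingularCohomology` — `H^p_X(W; ULift R) ≅ H^p(↥W; R)`;
* `subsetCochains.isZero_homology_of_contractibleSpace` — **`H^p_X(W; ULift R) = 0` for `p > 0`
  when `↥W` is contractible** (the input for "`Ȟ^p(K) = 0`, `p > 0`, when `K` has arbitrarily
  small contractible neighbourhoods", via `Cech.eq_zero_of_cofinal_zero`).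

Everything is proved; no named facts.

## References

* H. Miller, *Lectures on Algebraic Topology*, World Scientific 2020, §34 (Lemma 34.5), proof of
  Thm. 37.1 (1). [Miller2020]
* A. Hatcher, *Algebraic Topology*, CUP 2002, §3.1 pp. 197–201. [HatcherAT2002]
-/

noncomputable section

open CategoryTheory Limits

universe u v

namespace Literature.AlgebraicTopology.SingularHomology

namespace subsetCochains

variable (R : Type v) [CommRing R] {X : Type u} [TopologicalSpace X]

/-- **`Hom_R(C_X(W), ULift R) ≅ C^•(↥W; R)`**: the cochains of `W` computed in `C(X)` are the
singular cochains of the subspace `↥W` (Hatcher 2002, §3.1 p. 197, cochains as the dual of chains;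
the chains of `↥W` are the chains of `X` in `W`, §2.1). [cite: HatcherAT2002, §3.1 p. 197] -/
def isoSingularCochainComplex (W : Set X) :
    subsetCochains R (ModuleCat.of R (ULift.{u} R)) W ≅ singularCochainComplex R R (↥W) :=
  dualMapIso (N := ModuleCat.of R (ULift.{u} R)) (subspaceIso R R X W) ≪≫
    (dualMapIso (N := ModuleCat.of R (ULift.{u} R)) (csingularChainComplex.compIso R R (↥W))).symm ≪≫
      (singularCochainComplex.cochainIso R R (↥W)).symm

/-- **`H^p_X(W; ULift R) ≅ H^p(↥W; R)`** (Hatcher 2002, §3.1 p. 197). [cite: HatcherAT2002, §3.1 p. 197] -/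
def homologyIsoSingularCohomology (W : Set X) (p : ℕ) :
    (subsetCochains R (ModuleCat.of R (ULift.{u} R)) W).homology p ≅ singularCohomology R R (↥W) p :=
  (HomologicalComplex.homologyFunctor _ _ p).mapIso (isoSingularCochainComplex R W)

/-- **The cohomology of a contractible subset computed in `C(X)` vanishes in positive degrees**:
`H^p_X(W; ULift R) = 0` for `p > 0` if `↥W` is contractible (Hatcher 2002, §3.1 p. 201 with
p. 199; Miller 2020, proof of Thm. 37.1 (1), `H^*(U) ≅ H^*(*)` for neighbourhoods `U` of the
homotopy type of a point). [cite: Miller2020, Thm. 37.1 proof (1)] -/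
theorem isZero_homology_of_contractibleSpace (W : Set X) [ContractibleSpace ↥W] {p : ℕ} (hp : p ≠ 0) :
    IsZero ((subsetCochains R (ModuleCat.of R (ULift.{u} R)) W).homology p) :=
  IsZero.of_iso (singularCochainComplex.isZero_singularCohomology_of_subsingleton' hp)
    (homologyIsoSingularCohomology R W p ≪≫ (singularCohomology.isoOfContractible R R (↥W) p).symm)

/-- The same, as a vanishing statement for the `ModuleCat.of` of the cohomology module (the form
consumed by `Cech.eq_zero_of_cofinal_zero`). [cite: Miller2020, Thm. 37.1 proof (1)] -/
theorem isZero_of_homology_of_contractibleSpace (W : Set X) [ContractibleSpace ↥W] {p : ℕ}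
    (hp : p ≠ 0) :
    IsZero (ModuleCat.of R ((subsetCochains R (ModuleCat.of R (ULift.{u} R)) W).homology p)) :=
  isZero_homology_of_contractibleSpace R W hp

end subsetCochains

end Literature.AlgebraicTopology.SingularHomology
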